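import Summits.ABC.IUTFork.Joshi.UntiltNonIsometry
import Summits.ABC.IUTFork.Joshi.ATSObjEmbeddingNorm
import Mathlib.Analysis.AbsoluteValue.Equivalence
import Mathlib.Analysis.SpecificLimits.Normed
import HarnessLib

/-!
# [J-I] §3 «topologically isomorphic» untilts ⟺ «isometric up to a dilation of the value group» — the CONVERSE direction, PROVED

Proof-only companion (abc-iut cell, branch E, rung LADDER-ABC:A2.E; seat abc-iut-E-t55, [J-I] typer-side reader #3) of abc-iut-E-t16's
`Joshi/UntiltNonIsometry.lean` (p431173: a dilated isometry `‖e x‖ = ‖x‖^s` IS a topological isomorphism, `Untilt.topIso_of_norm_rpow`)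
over E-t1's carriers `Untilt`, `Untilt.TopEquiv`, `Untilt.TopIso`, `ATSObj`, `ATSObj.Iso` (p428170) and my `ATSObj.exists_norm_emb_eq_rpow`
(p437707) — all imported BY NAME, nothing restated, no definition.

Source: K. Joshi, arXiv 2106.11452 **v4** (UNREFEREED; bib `Joshi2021ATS1`; typed AS A CANDIDATE, D-0012): §3.7 p.10 l.15–24 «there exist
untilts of `ℂ_p^♭` which are not topologically isomorphic … all characteristic zero untilts of `ℂ_p^♭` … are abstractly isomorphic fields but
may not be topologically isomorphic»; 2021 chunk p0013 «not topologically isomorphic (and hence non-isometric)»; §10 / Thm. 5.4.1 «the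
`p`-adic metrics … are scaled»; proof of Thm. 3.16.1 p.15 l.50 – p.16 l.3 (a bounded = continuous field isomorphism of untilts is an
isomorphism of valued fields, [BGR 1.2.5/4, 1.3.1/4]; E-t24's `Untilt.TopEquiv.ofBounded`, p432511).

WHAT IS PROVED (classical: a homeomorphic isomorphism of complete rank-one valued fields identifies the valuations up to a positive
power — Mathlib `AbsoluteValue.isEquiv_iff_lt_one_iff`, `isEquiv_iff_exists_rpow_eq`, `tendsto_pow_atTop_nhds_zero_iff_norm_lt_one`):
* `Untilt.TopEquiv.norm_lt_one_iff` — a topological isomorphism of untilts preserves «`‖x‖ < 1`» (topological nilpotence);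
* **`Untilt.TopEquiv.exists_norm_eq_rpow`** — every topological isomorphism `e` of untilts is a DILATED ISOMETRY: `‖e x‖ = ‖x‖^s` for one
  `s > 0` and all `x`; with E-t16's converse, **`Untilt.topIso_iff_exists_norm_rpow`**: `U`, `V` are topologically isomorphic IFF some field
  isomorphism is a dilated isometry — the kernel meaning of E-t1's central predicate `Untilt.TopIso`;
* `Untilt.TopEquiv.norm_le_one_iff` / `_eq_one_iff` — valuation rings and unit groups correspond (the [BGR] conclusion of the proof of
  Thm. 3.16.1: «the valued fields `K_i` have isomorphic valuation rings»); `Untilt.TopEquiv.norm_natCast_rpow` — `‖p‖_V = ‖p‖_U^s`, so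
  **`Untilt.TopEquiv.norm_eq_of_norm_p_eq`**: topologically isomorphic untilts with the SAME normalisation `‖p‖_U = ‖p‖_V` are ISOMETRIC
  through every topological isomorphism («and hence non-isometric» made an equivalence under a common normalisation);
* `ATSObj.norm_emb_eq_of_norm_p` — for an object whose untilt is NORMALISED by `‖p‖_K = p⁻¹` (e.g. `ℂ_p`) the exponent of
  `ATSObj.exists_norm_emb_eq_rpow` (p437707) is `1`: `emb : E′ ↪ K` is a LITERAL isometry ([J-III] Prop. 8.3.1.1 (1) read literally);
* **`ATSObj.Iso.exists_norm_emb_eq_rpow`** — isomorphic OBJECTS of `𝔍(X,E)` have embeddings `E′ ↪ K` whose pulled-back norms differ by a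
  positive power along the base isomorphism (the exponent class is an isomorphism invariant; cf. Thm. 5.4.1 / `ATSObj.thm541_obj`).
Proving these takes NO side on [IUTchIII] Cor. 3.12 or on any author; typed ≠ endorsed.
-/

noncomputable section

namespace Summit.ABC.IUTFork.Joshi

open Filter Topology

namespace Untilt

variable {p : ℕ} [Fact p.Prime] {U V : Untilt p}

namespace TopEquiv

/-- A topological isomorphism of untilts preserves topological nilpotence: `‖e x‖ < 1 ↔ ‖x‖ < 1` (`xⁿ → 0` is a topological statement,
Mathlib `tendsto_pow_atTop_nhds_zero_iff_norm_lt_one`). [folklore] -/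
theorem norm_lt_one_iff (e : U.TopEquiv V) (x : U.K) : ‖e.toRingEquiv x‖ < 1 ↔ ‖x‖ < 1 := by
  rw [← tendsto_pow_atTop_nhds_zero_iff_norm_lt_one, ← tendsto_pow_atTop_nhds_zero_iff_norm_lt_one]
  have hpow : (fun n : ℕ => e.toRingEquiv x ^ n) = e.toRingEquiv ∘ fun n : ℕ => x ^ n := by
    funext n; simp [map_pow]
  constructor
  · intro h
    have h' : Tendsto (e.toRingEquiv.symm ∘ fun n : ℕ => e.toRingEquiv x ^ n) atTop (𝓝 (e.toRingEquiv.symm 0)) :=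
      (e.continuous_invFun.tendsto 0).comp h
    rw [map_zero] at h'
    refine h'.congr fun n => ?_
    simp [map_pow]
  · intro h
    rw [hpow, ← map_zero e.toRingEquiv]
    exact (e.continuous_toFun.tendsto 0).comp h

/-- **A topological isomorphism of untilts is a DILATED ISOMETRY**: `‖e x‖ = ‖x‖^s` for one real `s > 0` and every `x` — the two real
absolute values `‖·‖_U` and `‖e(·)‖_V` on `U.K` have the same open unit ball, hence are equivalent, hence powers of each other
(Mathlib `AbsoluteValue.isEquiv_iff_lt_one_iff`, `isEquiv_iff_exists_rpow_eq`). Converse of E-t16's `topIso_of_norm_rpow`. [folklore] -/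
theorem exists_norm_eq_rpow (e : U.TopEquiv V) : ∃ s : ℝ, 0 < s ∧ ∀ x : U.K, ‖e.toRingEquiv x‖ = ‖x‖ ^ s := by
  let v : AbsoluteValue U.K ℝ := NormedField.toAbsoluteValue U.K
  let w : AbsoluteValue U.K ℝ :=
    (NormedField.toAbsoluteValue V.K).comp (f := e.toRingEquiv.toRingHom) e.toRingEquiv.toRingHom.injective
  have hvw : v.IsEquiv w := by
    refine AbsoluteValue.isEquiv_iff_lt_one_iff.2 fun x => ?_
    change ‖x‖ < 1 ↔ ‖e.toRingEquiv x‖ < 1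
    exact (e.norm_lt_one_iff x).symm
  obtain ⟨s, hs, hfun⟩ := AbsoluteValue.isEquiv_iff_exists_rpow_eq.1 hvw
  exact ⟨s, hs, fun x => (congrFun hfun x).symm⟩

/-- Valuation rings correspond under a topological isomorphism: `‖e x‖ ≤ 1 ↔ ‖x‖ ≤ 1` (the [BGR 1.2.5/4] step of the proof of [J-I] Thm.
3.16.1, p.15 l.56 – p.16 l.2: «the valued fields `K_i` have isomorphic valuation rings»). [folklore] -/
theorem norm_le_one_iff (e : U.TopEquiv V) (x : U.K) : ‖e.toRingEquiv x‖ ≤ 1 ↔ ‖x‖ ≤ 1 := by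
  obtain ⟨s, hs, h⟩ := e.exists_norm_eq_rpow
  rw [h x]
  exact ATSObj.rpow_le_one_iff_of_exponent_pos (norm_nonneg _) hs

/-- Unit groups of the valuation rings correspond: `‖e x‖ = 1 ↔ ‖x‖ = 1`. [folklore] -/
theorem norm_eq_one_iff (e : U.TopEquiv V) (x : U.K) : ‖e.toRingEquiv x‖ = 1 ↔ ‖x‖ = 1 := by
  obtain ⟨s, hs, h⟩ := e.exists_norm_eq_rpow
  rw [h x]
  exact ATSObj.rpow_eq_one_iff_of_exponent_pos (norm_nonneg _) hs

/-- The dilation exponent is read off at `p`: `‖p‖_V = ‖p‖_U^s` (both in `(0,1)`). [folklore] -/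
theorem norm_natCast_rpow (e : U.TopEquiv V) {s : ℝ} (h : ∀ x : U.K, ‖e.toRingEquiv x‖ = ‖x‖ ^ s) :
    ‖(p : V.K)‖ = ‖(p : U.K)‖ ^ s := by
  rw [← h, map_natCast]

/-- **Same normalisation ⇒ ISOMETRY**: if the two untilts give `p` the same norm, every topological isomorphism between them is an
isometry (the exponent is forced to be `1` since `0 < ‖p‖ < 1`). Kernel form of «topologically isomorphic ⟺ isometric» under a common
normalisation; contrapositive of [J-I]'s «not topologically isomorphic (and hence non-isometric)». [folklore] -/
theorem norm_eq_of_norm_p_eq (e : U.TopEquiv V) (hp : ‖(p : U.K)‖ = ‖(p : V.K)‖) (x : U.K) : ‖e.toRingEquiv x‖ = ‖x‖ := by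
  obtain ⟨s, hs, h⟩ := e.exists_norm_eq_rpow
  have hpU0 : 0 < ‖(p : U.K)‖ := by
    rw [norm_pos_iff]; exact Nat.cast_ne_zero.2 (Fact.out : p.Prime).ne_zero
  have hpU1 : ‖(p : U.K)‖ < 1 := U.norm_p_lt_one
  have hps : ‖(p : U.K)‖ ^ s = ‖(p : U.K)‖ := by rw [← e.norm_natCast_rpow h, hp]
  have hs1 : s = 1 := by
    have hlog := congrArg Real.log hps
    rw [Real.log_rpow hpU0] at hlog
    have hne : Real.log ‖(p : U.K)‖ ≠ 0 := Real.log_ne_zero_of_pos_of_ne_one hpU0 (ne_of_lt hpU1)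
    field_simp at hlog
    linarith
  rw [h x, hs1, Real.rpow_one]

end TopEquiv

/-- **`TopIso` characterised**: two untilts are topologically isomorphic (E-t1's `Untilt.TopIso`) IFF some field isomorphism between them
is a dilated isometry `‖e x‖ = ‖x‖^s`, `s > 0` (→ this file; ← E-t16's `topIso_of_norm_rpow`, p431173). [folklore] -/
theorem topIso_iff_exists_norm_rpow :
    U.TopIso V ↔ ∃ (e : U.K ≃+* V.K) (s : ℝ), 0 < s ∧ ∀ x : U.K, ‖e x‖ = ‖x‖ ^ s := by
  constructor
  · rintro ⟨e⟩
    obtain ⟨s, hs, h⟩ := e.exists_norm_eq_rpow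
    exact ⟨e.toRingEquiv, s, hs, h⟩
  · rintro ⟨e, s, hs, h⟩
    exact topIso_of_norm_rpow e s hs h

/-- Under a common normalisation `‖p‖_U = ‖p‖_V`: topologically isomorphic IFF isometrically isomorphic. [folklore] -/
theorem topIso_iff_exists_norm_eq (hp : ‖(p : U.K)‖ = ‖(p : V.K)‖) :
    U.TopIso V ↔ ∃ e : U.K ≃+* V.K, ∀ x : U.K, ‖e x‖ = ‖x‖ := by
  constructor
  · rintro ⟨e⟩
    exact ⟨e.toRingEquiv, e.norm_eq_of_norm_p_eq hp⟩
  · rintro ⟨e, h⟩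
    exact topIso_of_norm_eq e h

end Untilt

/-! ## Isomorphic objects of `𝔍(X,E)`: the pulled-back norms on `E′` differ by a positive power along the base isomorphism -/

namespace ATSObj

variable {p : ℕ} [Fact p.Prime] {X : Literature.AnabelianGeometry.SemiGraphs.TemperedCurve p} {A B : ATSObj X}

/-- **Isomorphic objects have dilation-related embeddings**: for an isomorphism `(Y/E′, E′ ↪ K, α) ⥲ (Y₁/E′₁, E′₁ ↪ K₁, α₁)` (E-t1's
`ATSObj.Iso`: base isomorphism `E′ ≅ E′₁`, TOPOLOGICAL isomorphism `K ≅ K₁` compatible with the embeddings), `‖emb₁ (baseEquiv x)‖_{K₁} =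
‖emb x‖_K^s` for one `s > 0` and all `x ∈ E′`. [folklore] -/
theorem Iso.exists_norm_emb_eq_rpow (i : A.Iso B) :
    ∃ s : ℝ, 0 < s ∧ ∀ x : A.Y.K, ‖B.emb (i.baseEquiv x)‖ = ‖A.emb x‖ ^ s := by
  obtain ⟨s, hs, h⟩ := i.fieldEquiv.exists_norm_eq_rpow
  exact ⟨s, hs, fun x => by rw [← i.emb_comm x, h]⟩

/-- … and if the two untilts carry the same normalisation of `p`, the embeddings are ISOMETRICALLY related along the isomorphism.
[folklore] -/
theorem Iso.norm_emb_eq (i : A.Iso B) (hp : ‖(p : A.U.K)‖ = ‖(p : B.U.K)‖) (x : A.Y.K) :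
    ‖B.emb (i.baseEquiv x)‖ = ‖A.emb x‖ := by
  rw [← i.emb_comm x, i.fieldEquiv.norm_eq_of_norm_p_eq hp]

/-- **LITERAL isometry under the standard normalisation** ([J-III] Prop. 8.3.1.1 (1) «isometrically embedded ℚ_{p_v}» read
literally, c = 1): if the untilt `K` of the object is normalised by `‖p‖_K = p⁻¹` (as `ℂ_p` is), then the exponent of
`ATSObj.exists_norm_emb_eq_rpow` is `1` and `emb : E′ ↪ K` is an ISOMETRY for the `p`-adic norm of `E′ ⊆ ℚ̄_p`. (For a general E-t1
`Untilt` the norm is only fixed up to a positive power, whence the exponent.) [folklore] -/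
theorem norm_emb_eq_of_norm_p (A : ATSObj X) (hp : ‖(p : A.U.K)‖ = (p : ℝ)⁻¹) (x : A.Y.K) :
    ‖A.emb x‖ = ‖((x : AlgebraicClosure ℚ_[p]) : PadicAlgCl p)‖ := by
  obtain ⟨c, hc, h⟩ := A.exists_norm_emb_eq_rpow
  have hp1 : 1 < (p : ℝ) := by exact_mod_cast (Fact.out : p.Prime).one_lt
  have hpinv0 : 0 < (p : ℝ)⁻¹ := inv_pos.2 (by linarith)
  have hpinv1 : (p : ℝ)⁻¹ < 1 := inv_lt_one_of_one_lt₀ hp1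
  have hpQ : ‖(((p : A.Y.K) : AlgebraicClosure ℚ_[p]) : PadicAlgCl p)‖ = (p : ℝ)⁻¹ := by
    have h1 : (((p : A.Y.K) : AlgebraicClosure ℚ_[p]) : PadicAlgCl p) = algebraMap ℚ_[p] (PadicAlgCl p) (p : ℚ_[p]) := by
      rw [map_natCast]; norm_cast
    rw [h1, PadicAlgCl.norm_extends, Padic.norm_p]
  have hpe : ‖A.emb (p : A.Y.K)‖ = (p : ℝ)⁻¹ := by rw [map_natCast, hp]
  have hc1 : c = 1 := by
    have hx := h (p : A.Y.K)
    rw [hpe, hpQ] at hx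
    have hlog := congrArg Real.log hx.symm
    rw [Real.log_rpow hpinv0] at hlog
    have hne : Real.log ((p : ℝ)⁻¹) ≠ 0 := Real.log_ne_zero_of_pos_of_ne_one hpinv0 (ne_of_lt hpinv1)
    exact mul_right_cancel₀ hne (hlog.trans (one_mul _).symm)
  rw [h x, hc1, Real.rpow_one]

end ATSObj

end Summit.ABC.IUTFork.Joshi

end
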